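import Literature.Geometry.Riemannian.MetricFlowHeatFlowLipschitz
import Literature.Geometry.Riemannian.MetricFlowVarianceBounds
import Literature.Geometry.Riemannian.MetricFlowHCenters
import Literature.MeasureTheory.OptimalTransport.KantorovichRubinstein
import HarnessLib

/-!
# Monotonicity of the `W₁`-distance between conjugate heat flows and the distance-expansion
# estimate `d_{W₁}(ν_{x₁;s}, ν_{x₂;s}) ≤ d_t(x₁, x₂)` (Bamler 2023, §3.2, Proposition
# "compare two conjugate heat flows", (b)–(c)), compact time-slices

R. Bamler, *Compactness theory of the space of super Ricci flows*, Invent. Math. 233 (2023), §3.2,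
the Proposition that *"allows us to compare two conjugate heat flows"* `(μⁱ_t)_{t ∈ I'}`:
(b) *"The quantity `d_{W₁}^{𝒳_t}(μ¹_t, μ²_t)` is non-decreasing in `t`"*;
(c) *"For any `x₁, x₂ ∈ 𝒳_t` the quantity `d_{W₁}^{𝒳_s}(ν_{x₁;s}, ν_{x₂;s})` is non-decreasing
in `s` and we have `d_{W₁}^{𝒳_s}(ν_{x₁;s}, ν_{x₂;s}) ≤ d_t(x₁, x₂)`"*.
Printed proof of (b): for `t₁ ≤ t₂` and a bounded `1`-Lipschitz `ũ : 𝒳_{t₁} → ℝ` let `u` be the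
heat flow with `u_{t₁} = ũ`; then `u_{t₂}` is `1`-Lipschitz (gradient estimate,
`MetricFlowHeatFlowLipschitz.lean`) and
`∫ ũ dμ¹_{t₁} − ∫ ũ dμ²_{t₁} = ∫ u_{t₂} dμ¹_{t₂} − ∫ u_{t₂} dμ²_{t₂} ≤ d_{W₁}(μ¹_{t₂}, μ²_{t₂})`;
*"Taking the supremum over all such `ũ` implies (b)"* — i.e. Kantorovich–Rubinstein duality at
time `t₁`. The tree's `wassersteinW1` (`MetricFlowConcentration.lean`) is the primal (coupling)
definition, and Kantorovich–Rubinstein duality is in the tree for COMPACT metric spaces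
(`Literature.MeasureTheory.OptimalTransport.exists_isCoupling_isKRPotential`); accordingly this
file proves (b) and (c) when the EARLIER time-slice is compact (e.g. for the metric flow of a
Ricci flow on a closed manifold):

* `exists_lipschitz_wassersteinW1_le` — KR duality read for `wassersteinW1`: on a compact metric
  space there is a continuous `1`-Lipschitz `ζ` with `d_{W₁}(μ, ν) ≤ ∫ ζ dμ − ∫ ζ dν`;
* `ofReal_integral_sub_integral_le_wassersteinW1` — the easy inequality
  `∫ u dμ − ∫ u dν ≤ d_{W₁}(μ, ν)` for bounded measurable `1`-Lipschitz `u` (any metric space);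
* `wassersteinW1_condKernel_le_edist` — **(c)**: `d_{W₁}^{𝒳_s}(ν_{x₁;s}, ν_{x₂;s}) ≤ d_t(x₁, x₂)`;
* `wassersteinW1_condKernel_mono` — **(c)**: `s ↦ d_{W₁}^{𝒳_s}(ν_{x₁;s}, ν_{x₂;s})` is
  non-decreasing;
* `IsConjugateHeatFlow.wassersteinW1_mono` — **(b)** for two conjugate heat flows over `I'`;
* `lintegral_lintegral_edist_le_wassersteinW1_add` — the coupling estimate of the proof of the
  Lemma of §4.2: `∫∫ d dν₁ dν₂ ≤ d_{W₁}(ν₁, ν₂) + √Var(ν₂)` (any separable metric space), and in an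
  `H`-concentrated flow `IsHConcentrated.lintegral_lintegral_edist_condKernel_le` (`+ √(H(t − s))`)
  and `IsHConcentrated.lintegral_lintegral_edist_condKernel_le_edist` — the first half of (4.3):
  `∫∫ d_s dν_{y₁;s} dν_{y₂;s} ≤ d_t(y₁, y₂) + √(H(t − s))` (compact `𝒳_s`);
* `IsHCenter.edist_le_edist_add` — the **distance-shrinking estimate for `H`-centers** of Bamler
  2023, §4 (display before §4.1): if `zᵢ ∈ 𝒳_s` is an `H`-center of `xᵢ ∈ 𝒳_t`, then
  `d_s(z₁, z₂) ≤ d_t(x₁, x₂) + 2√(H(t − s))` ((c), `d_{W₁}(δ_z, ν) ≤ √Var(δ_z, ν)` and the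
  triangle inequality integrated against a coupling).

Everything is proved; no definitions, no named facts. What is NOT here: (a) (mutual absolute
continuity), and (b)–(c) for non-compact earlier slices (Kantorovich–Rubinstein on Polish spaces).

## References

* R. H. Bamler, *Compactness theory of the space of super Ricci flows*, Invent. Math. 233 (2023),
  §3.2, Proposition (comparing two conjugate heat flows) (b), (c); §4, display before §4.1
  (distance shrinking for `H`-centers); §4.2, Lemma (almost monotonicity of `∫∫ d_t dμ_t dμ_t`),
  (4.3) and its proof. [Bamler2023]
* C. Villani, *Topics in Optimal Transportation*, GSM 58 (AMS 2003), Thm. 1.14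
  (Kantorovich–Rubinstein). [Villani2003]
-/

noncomputable section

open Set MeasureTheory Filter Metric
open scoped Topology NNReal ENNReal

namespace Literature.Geometry.Riemannian

open _root_.Literature.MeasureTheory.OptimalTransport (IsMetricCost IsKRPotential
  exists_isCoupling_isKRPotential integrable_continuousMap)

universe u

/-! ### Kantorovich–Rubinstein duality read for `wassersteinW1` -/

section KR

variable {X : Type u} [MetricSpace X] [MeasurableSpace X] [BorelSpace X]

omit [MeasurableSpace X] [BorelSpace X] in
/-- The distance of a metric space as a continuous cost on `X × X`. [folklore] -/
theorem isMetricCost_dist :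
    IsMetricCost (X := X) ⟨fun z ↦ dist z.1 z.2, continuous_fst.dist continuous_snd⟩ where
  self x := dist_self x
  symm x y := dist_comm x y
  triangle x y z := dist_triangle x y z

/-- **The easy half of Kantorovich–Rubinstein for `wassersteinW1`**: for probability measures
`μ, ν` on a metric space and a bounded measurable `1`-Lipschitz `u`,
`∫ u dμ − ∫ u dν ≤ d_{W₁}(μ, ν)` — for every coupling `q`,
`∫ u dμ − ∫ u dν = ∫ (u(x) − u(y)) dq ≤ ∫ d(x, y) dq`. [cite: Villani2003, Thm. 1.14] -/
theorem ofReal_integral_sub_integral_le_wassersteinW1 [SecondCountableTopology X] (μ ν : Measure X)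
    [IsProbabilityMeasure μ] [IsProbabilityMeasure ν] {u : X → ℝ} (hum : Measurable u) {C : ℝ} (hC : ∀ x, |u x| ≤ C)
    (hu : LipschitzWith 1 u) :
    ENNReal.ofReal (∫ x, u x ∂μ - ∫ x, u x ∂ν) ≤ wassersteinW1 μ ν := by
  refine le_iInf fun q ↦ ?_
  obtain ⟨q, hqP, hq1, hq2⟩ := q
  haveI := hqP
  show ENNReal.ofReal (∫ x, u x ∂μ - ∫ x, u x ∂ν) ≤ ∫⁻ p, edist p.1 p.2 ∂q
  by_cases htop : ∫⁻ p, edist p.1 p.2 ∂q = ∞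
  · rw [htop]; exact le_top
  -- `d` is `q`-integrable
  have hdm : Measurable fun p : X × X ↦ dist p.1 p.2 := continuous_dist.measurable
  have hdi : Integrable (fun p : X × X ↦ dist p.1 p.2) q := by
    refine ⟨hdm.aestronglyMeasurable, ?_⟩
    rw [hasFiniteIntegral_iff_norm]
    have h1 : (fun p : X × X ↦ ENNReal.ofReal ‖dist p.1 p.2‖) = fun p ↦ edist p.1 p.2 := by
      funext p
      rw [Real.norm_eq_abs, abs_of_nonneg dist_nonneg, edist_dist]
    rw [h1]
    exact lt_top_iff_ne_top.2 htop
  -- the marginal integrals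
  have hu1 : Integrable (fun p : X × X ↦ u p.1) q :=
    MetricFlow.integrable_of_bounded_measurable (hum.comp measurable_fst) fun p ↦ hC p.1
  have hu2 : Integrable (fun p : X × X ↦ u p.2) q :=
    MetricFlow.integrable_of_bounded_measurable (hum.comp measurable_snd) fun p ↦ hC p.2
  have hμ : ∫ x, u x ∂μ = ∫ p, u p.1 ∂q := by
    rw [← hq1, Measure.fst, integral_map measurable_fst.aemeasurable hum.aestronglyMeasurable]
  have hν : ∫ x, u x ∂ν = ∫ p, u p.2 ∂q := by
    rw [← hq2, Measure.snd, integral_map measurable_snd.aemeasurable hum.aestronglyMeasurable]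
  have hle : ∫ x, u x ∂μ - ∫ x, u x ∂ν ≤ ∫ p, dist p.1 p.2 ∂q := by
    rw [hμ, hν, ← integral_sub hu1 hu2]
    refine integral_mono (hu1.sub hu2) hdi fun p ↦ ?_
    have h := hu.dist_le_mul p.1 p.2
    rw [NNReal.coe_one, one_mul, Real.dist_eq] at h
    exact (le_abs_self _).trans h
  calc ENNReal.ofReal (∫ x, u x ∂μ - ∫ x, u x ∂ν) ≤ ENNReal.ofReal (∫ p, dist p.1 p.2 ∂q) :=
        ENNReal.ofReal_le_ofReal hle
    _ = ∫⁻ p, edist p.1 p.2 ∂q := by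
        rw [ofReal_integral_eq_lintegral_ofReal hdi (Eventually.of_forall fun p ↦ dist_nonneg)]
        simp_rw [← edist_dist]

/-- **The coupling estimate of Bamler 2023, §4.2, proof of the Lemma** (first display): for
probability measures `ν₁, ν₂` on a separable metric space,
`∫∫ d(x₁, x₂') dν₁(x₁) dν₂(x₂') ≤ d_{W₁}(ν₁, ν₂) + √Var(ν₂)` — for every coupling `q` of
`ν₁, ν₂`: `∫∫ d(x₁, x₂') dν₁ dν₂ = ∫∫ d(x₁, x₂') dq(x₁, x₂) dν₂(x₂') ≤ ∫ d dq + ∫∫ d dν₂ dν₂ ≤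
∫ d dq + √Var(ν₂)` (triangle inequality through `x₂`, Cauchy–Schwarz).
[cite: Bamler2023, §4.2, proof of the Lemma (almost monotonicity), first display] -/
theorem lintegral_lintegral_edist_le_wassersteinW1_add [SecondCountableTopology X]
    (ν₁ ν₂ : Measure X) [IsProbabilityMeasure ν₁] [IsProbabilityMeasure ν₂] :
    ∫⁻ x₁, ∫⁻ x₂, edist x₁ x₂ ∂ν₂ ∂ν₁ ≤ wassersteinW1 ν₁ ν₂ + (variance ν₂ ν₂) ^ (1 / 2 : ℝ) := by
  have hmeas : Measurable fun x₁ : X ↦ ∫⁻ x₂, edist x₁ x₂ ∂ν₂ :=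
    measurable_edist.lintegral_prod_right'
  have hq : ∀ q : {q : Measure (X × X) // IsCoupling ν₁ ν₂ q},
      ∫⁻ x₁, ∫⁻ x₂, edist x₁ x₂ ∂ν₂ ∂ν₁ ≤
        ∫⁻ p, edist p.1 p.2 ∂(q : Measure (X × X)) + (variance ν₂ ν₂) ^ (1 / 2 : ℝ) := by
    rintro ⟨q, hqP, hq1, hq2⟩
    haveI := hqP
    -- read the outer `ν₁`-integral and the second term through the marginals of `q`
    have hfst : ∫⁻ x₁, ∫⁻ x₂, edist x₁ x₂ ∂ν₂ ∂ν₁ = ∫⁻ p, ∫⁻ x₂, edist p.1 x₂ ∂ν₂ ∂q := by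
      have h : ∫⁻ x₁, ∫⁻ x₂, edist x₁ x₂ ∂ν₂ ∂q.fst = ∫⁻ p, ∫⁻ x₂, edist p.1 x₂ ∂ν₂ ∂q := by
        rw [Measure.fst, lintegral_map hmeas measurable_fst]
      rwa [hq1] at h
    have hsnd : ∫⁻ p, ∫⁻ x₂, edist p.2 x₂ ∂ν₂ ∂q = ∫⁻ x₁, ∫⁻ x₂, edist x₁ x₂ ∂ν₂ ∂ν₂ := by
      have h : ∫⁻ x₁, ∫⁻ x₂, edist x₁ x₂ ∂ν₂ ∂q.snd = ∫⁻ p, ∫⁻ x₂, edist p.2 x₂ ∂ν₂ ∂q := by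
        rw [Measure.snd, lintegral_map hmeas measurable_snd]
      rw [hq2] at h
      exact h.symm
    have hmeas2 : Measurable fun p : X × X ↦ ∫⁻ x₂, edist p.2 x₂ ∂ν₂ := hmeas.comp measurable_snd
    calc ∫⁻ x₁, ∫⁻ x₂, edist x₁ x₂ ∂ν₂ ∂ν₁ = ∫⁻ p, ∫⁻ x₂, edist p.1 x₂ ∂ν₂ ∂q := hfst
      _ ≤ ∫⁻ p, ∫⁻ x₂, edist p.1 p.2 + edist p.2 x₂ ∂ν₂ ∂q :=
          lintegral_mono fun p ↦ lintegral_mono fun x₂ ↦ edist_triangle _ _ _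
      _ = ∫⁻ p, edist p.1 p.2 + ∫⁻ x₂, edist p.2 x₂ ∂ν₂ ∂q := by
          refine lintegral_congr fun p ↦ ?_
          rw [lintegral_add_left measurable_const, lintegral_const, measure_univ, mul_one]
      _ = ∫⁻ p, edist p.1 p.2 ∂q + ∫⁻ p, ∫⁻ x₂, edist p.2 x₂ ∂ν₂ ∂q :=
          lintegral_add_left measurable_edist _
      _ = ∫⁻ p, edist p.1 p.2 ∂q + ∫⁻ x₁, ∫⁻ x₂, edist x₁ x₂ ∂ν₂ ∂ν₂ := by rw [hsnd]
      _ ≤ ∫⁻ p, edist p.1 p.2 ∂q + (variance ν₂ ν₂) ^ (1 / 2 : ℝ) :=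
          add_le_add le_rfl (lintegral_lintegral_edist_le_sqrt_variance ν₂ ν₂)
  calc ∫⁻ x₁, ∫⁻ x₂, edist x₁ x₂ ∂ν₂ ∂ν₁
      ≤ ⨅ q : {q : Measure (X × X) // IsCoupling ν₁ ν₂ q},
          (∫⁻ p, edist p.1 p.2 ∂(q : Measure (X × X)) + (variance ν₂ ν₂) ^ (1 / 2 : ℝ)) :=
        le_iInf hq
    _ = wassersteinW1 ν₁ ν₂ + (variance ν₂ ν₂) ^ (1 / 2 : ℝ) := ENNReal.iInf_add.symm


variable [CompactSpace X]

/-- **Kantorovich–Rubinstein duality read for `wassersteinW1`, compact case**: for probability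
measures `μ, ν` on a compact metric space there is a continuous `1`-Lipschitz `ζ : X → ℝ` with
`d_{W₁}(μ, ν) ≤ ∫ ζ dμ − ∫ ζ dν` (the optimal plan `π` and potential `ζ` of
`exists_isCoupling_isKRPotential` for the cost `d`: `d_{W₁} ≤ ∫ d dπ = ∫ ζ dμ − ∫ ζ dν`).
[cite: Villani2003, Thm. 1.14] -/
theorem exists_lipschitz_wassersteinW1_le (μ ν : Measure X) [IsProbabilityMeasure μ]
    [IsProbabilityMeasure ν] :
    ∃ ζ : X → ℝ, Continuous ζ ∧ LipschitzWith 1 ζ ∧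
      wassersteinW1 μ ν ≤ ENNReal.ofReal (∫ x, ζ x ∂μ - ∫ x, ζ x ∂ν) := by
  have hmass : μ univ = ν univ := by rw [measure_univ, measure_univ]
  obtain ⟨π, ζ, hπ, hζ, heq, -, -, -⟩ :=
    exists_isCoupling_isKRPotential (μ := μ) (ν := ν) isMetricCost_dist hmass
  -- `π` is a coupling in the sense of `wassersteinW1`
  have hπuniv : π univ = 1 := by
    rw [← measure_univ (μ := μ), ← hπ.map_fst, Measure.map_apply measurable_fst MeasurableSet.univ,
      preimage_univ]
  haveI : IsProbabilityMeasure π := ⟨hπuniv⟩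
  have hcoup : IsCoupling μ ν π := ⟨inferInstance, hπ.map_fst, hπ.map_snd⟩
  refine ⟨ζ, ζ.continuous, LipschitzWith.of_le_add fun x y ↦ ?_, ?_⟩
  · have h := hζ x y
    simp only [ContinuousMap.coe_mk] at h
    linarith
  refine (wassersteinW1_le_lintegral hcoup).trans (le_of_eq ?_)
  have hdi : Integrable (fun p : X × X ↦ dist p.1 p.2) π :=
    integrable_continuousMap π ⟨fun z ↦ dist z.1 z.2, continuous_fst.dist continuous_snd⟩
  rw [← heq]
  show ∫⁻ p, edist p.1 p.2 ∂π = ENNReal.ofReal (∫ p, dist p.1 p.2 ∂π)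
  rw [ofReal_integral_eq_lintegral_ofReal hdi (Eventually.of_forall fun p ↦ dist_nonneg)]
  simp_rw [← edist_dist]

omit [MeasurableSpace X] [BorelSpace X] in
/-- A continuous real function on a compact space is bounded in absolute value. [folklore] -/
theorem exists_abs_le_of_continuous {ζ : X → ℝ} (hζ : Continuous ζ) : ∃ C : ℝ, ∀ x, |ζ x| ≤ C := by
  obtain ⟨C, hC⟩ := isCompact_univ.exists_bound_of_continuousOn hζ.continuousOn
  exact ⟨C, fun x ↦ by rw [← Real.norm_eq_abs]; exact hC x (mem_univ x)⟩

end KR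

/-! ### Bamler 2023, §3.2: comparing conjugate heat flows, (b) and (c) -/

namespace MetricFlow

variable {I : Set ℝ} {𝒳 : MetricFlow.{u} I}

variable (𝒳) in
/-- **Distance expansion in the `W₁`-sense** (Bamler 2023, §3.2, Proposition (comparing two
conjugate heat flows) (c): *"`d_{W₁}^{𝒳_s}(ν_{x₁;s}, ν_{x₂;s}) ≤ d_t(x₁, x₂)`"*), for a compact
earlier slice `𝒳_s`: by Kantorovich–Rubinstein there is a `1`-Lipschitz `ζ` with
`d_{W₁}(ν_{x₁;s}, ν_{x₂;s}) ≤ ∫ ζ dν_{x₁;s} − ∫ ζ dν_{x₂;s} = u_t(x₁) − u_t(x₂)` for the heat flow `u`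
of `ζ`, and `u_t` is `1`-Lipschitz. [cite: Bamler2023, §3.2, Proposition (comparing two conjugate heat flows) (c)] -/
theorem wassersteinW1_condKernel_le_edist {s t : I} [CompactSpace (𝒳.Slice s)]
    (hst : (s : ℝ) ≤ t) (x₁ x₂ : 𝒳.Slice t) :
    wassersteinW1 (𝒳.condKernel x₁ s) (𝒳.condKernel x₂ s) ≤ edist x₁ x₂ := by
  haveI := 𝒳.isProbabilityMeasure_condKernel x₁ hst
  haveI := 𝒳.isProbabilityMeasure_condKernel x₂ hst
  obtain ⟨ζ, hζc, hζl, hW⟩ :=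
    exists_lipschitz_wassersteinW1_le (𝒳.condKernel x₁ s) (𝒳.condKernel x₂ s)
  obtain ⟨C, hC⟩ := exists_abs_le_of_continuous hζc
  have hlip : LipschitzWith 1 (𝒳.heatFlowOf s ζ t) :=
    𝒳.lipschitzWith_heatFlowOf hst hζc.measurable hC hζl
  refine hW.trans ?_
  rw [edist_dist]
  refine ENNReal.ofReal_le_ofReal ?_
  have h := hlip.dist_le_mul x₁ x₂
  rw [NNReal.coe_one, one_mul, Real.dist_eq, heatFlowOf_apply, heatFlowOf_apply] at h
  exact (le_abs_self _).trans h

variable (𝒳) in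
/-- **`s ↦ d_{W₁}^{𝒳_s}(ν_{x₁;s}, ν_{x₂;s})` is non-decreasing** (Bamler 2023, §3.2, Proposition
(comparing two conjugate heat flows) (c)), for a compact earlier slice `𝒳_{s₁}`: with a
Kantorovich–Rubinstein potential `ζ` at time `s₁` and its heat flow `u`,
`d_{W₁}(s₁) ≤ ∫ ζ dν_{x₁;s₁} − ∫ ζ dν_{x₂;s₁} = ∫ u_{s₂} dν_{x₁;s₂} − ∫ u_{s₂} dν_{x₂;s₂} ≤ d_{W₁}(s₂)`
(reproduction formula; `u_{s₂}` is `1`-Lipschitz). [cite: Bamler2023, §3.2, Proposition (comparing two conjugate heat flows) (c)] -/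
theorem wassersteinW1_condKernel_mono {s₁ s₂ t : I} [CompactSpace (𝒳.Slice s₁)]
    (h12 : (s₁ : ℝ) ≤ s₂) (h2t : (s₂ : ℝ) ≤ t) (x₁ x₂ : 𝒳.Slice t) :
    wassersteinW1 (𝒳.condKernel x₁ s₁) (𝒳.condKernel x₂ s₁) ≤
      wassersteinW1 (𝒳.condKernel x₁ s₂) (𝒳.condKernel x₂ s₂) := by
  haveI := 𝒳.isProbabilityMeasure_condKernel x₁ (h12.trans h2t)
  haveI := 𝒳.isProbabilityMeasure_condKernel x₂ (h12.trans h2t)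
  haveI := 𝒳.isProbabilityMeasure_condKernel x₁ h2t
  haveI := 𝒳.isProbabilityMeasure_condKernel x₂ h2t
  obtain ⟨ζ, hζc, hζl, hW⟩ :=
    exists_lipschitz_wassersteinW1_le (𝒳.condKernel x₁ s₁) (𝒳.condKernel x₂ s₁)
  obtain ⟨C, hC⟩ := exists_abs_le_of_continuous hζc
  set u : 𝒳.Slice s₂ → ℝ := 𝒳.heatFlowOf s₁ ζ s₂ with hu_def
  have hum : Measurable u := 𝒳.measurable_heatFlowOf h12 hζc.measurable
  have huC : ∀ y, |u y| ≤ C := fun y ↦ 𝒳.abs_heatFlowOf_le h12 hC y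
  have hul : LipschitzWith 1 u := 𝒳.lipschitzWith_heatFlowOf h12 hζc.measurable hC hζl
  -- `∫ ζ dν_{xᵢ;s₁} = ∫ u dν_{xᵢ;s₂}` (reproduction formula)
  have hrep : ∀ x : 𝒳.Slice t,
      ∫ z, ζ z ∂(𝒳.condKernel x s₁) = ∫ y, u y ∂(𝒳.condKernel x s₂) := fun x ↦
    (𝒳.integral_integral_condKernel h12 h2t x hζc.measurable hC).symm
  haveI : SecondCountableTopology (𝒳.Slice s₂) := UniformSpace.secondCountable_of_separable _
  refine hW.trans ?_
  rw [hrep x₁, hrep x₂]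
  exact ofReal_integral_sub_integral_le_wassersteinW1 _ _ hum huC hul

/-- **The `W₁`-distance between two conjugate heat flows is non-decreasing in time** (Bamler
2023, §3.2, Proposition (comparing two conjugate heat flows) (b): *"The quantity
`d_{W₁}^{𝒳_t}(μ¹_t, μ²_t)` is non-decreasing in `t`"*), for a compact earlier slice `𝒳_{t₁}`;
printed proof: Kantorovich–Rubinstein at `t₁`, the heat flow `u` of the potential, the gradient
estimate (`u_{t₂}` is `1`-Lipschitz), the constancy of `∫ u_t dμⁱ_t` and the easy inequality at
`t₂`. [cite: Bamler2023, §3.2, Proposition (comparing two conjugate heat flows) (b)] -/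
theorem IsConjugateHeatFlow.wassersteinW1_mono {I' : Set ℝ} {μ₁ μ₂ : ∀ t : I, Measure (𝒳.Slice t)}
    (hμ₁ : 𝒳.IsConjugateHeatFlow I' μ₁) (hμ₂ : 𝒳.IsConjugateHeatFlow I' μ₂) {t₁ t₂ : I}
    [CompactSpace (𝒳.Slice t₁)] (ht₁ : (t₁ : ℝ) ∈ I') (ht₂ : (t₂ : ℝ) ∈ I')
    (h : (t₁ : ℝ) ≤ t₂) :
    wassersteinW1 (μ₁ t₁) (μ₂ t₁) ≤ wassersteinW1 (μ₁ t₂) (μ₂ t₂) := by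
  haveI := hμ₁.1 t₁ ht₁
  haveI := hμ₂.1 t₁ ht₁
  haveI := hμ₁.1 t₂ ht₂
  haveI := hμ₂.1 t₂ ht₂
  obtain ⟨ζ, hζc, hζl, hW⟩ := exists_lipschitz_wassersteinW1_le (μ₁ t₁) (μ₂ t₁)
  obtain ⟨C, hC⟩ := exists_abs_le_of_continuous hζc
  -- the heat flow of `ζ` over `I'' = I' ∩ [t₁, ∞)` and the two conjugate heat flows there
  set I'' : Set ℝ := I' ∩ Ici (t₁ : ℝ) with hI''
  have hu : 𝒳.IsHeatFlow I'' (𝒳.heatFlowOf t₁ ζ) :=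
    𝒳.isHeatFlow_heatFlowOf (fun t ht ↦ ht.2) hζc.measurable hC
  have hres : ∀ {μ : ∀ t : I, Measure (𝒳.Slice t)}, 𝒳.IsConjugateHeatFlow I' μ →
      𝒳.IsConjugateHeatFlow I'' μ := fun hμ ↦
    ⟨fun t ht ↦ hμ.1 t ht.1, fun s t hs ht hst ↦ hμ.2 hs.1 ht.1 hst⟩
  have h1 : (t₁ : ℝ) ∈ I'' := ⟨ht₁, Set.mem_Ici.2 le_rfl⟩
  have h2 : (t₂ : ℝ) ∈ I'' := ⟨ht₂, Set.mem_Ici.2 h⟩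
  have hum : Measurable (𝒳.heatFlowOf t₁ ζ t₁) := 𝒳.measurable_heatFlowOf le_rfl hζc.measurable
  have huC : ∀ y, |𝒳.heatFlowOf t₁ ζ t₁ y| ≤ C := fun y ↦ 𝒳.abs_heatFlowOf_le le_rfl hC y
  have hpair : ∀ {μ : ∀ t : I, Measure (𝒳.Slice t)}, 𝒳.IsConjugateHeatFlow I' μ →
      ∫ z, ζ z ∂(μ t₁) = ∫ y, 𝒳.heatFlowOf t₁ ζ t₂ y ∂(μ t₂) := by
    intro μ hμ
    have hp := hu.integral_eq_integral_of_isConjugateHeatFlow 𝒳 (hres hμ) h1 h2 h hum huC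
    rw [heatFlowOf_self] at hp
    exact hp
  haveI : SecondCountableTopology (𝒳.Slice t₂) := UniformSpace.secondCountable_of_separable _
  refine hW.trans ?_
  rw [hpair hμ₁, hpair hμ₂]
  exact ofReal_integral_sub_integral_le_wassersteinW1 _ _
    (𝒳.measurable_heatFlowOf h hζc.measurable) (fun y ↦ 𝒳.abs_heatFlowOf_le h hC y)
    (𝒳.lipschitzWith_heatFlowOf h hζc.measurable hC hζl)

/-- **Distance shrinking for `H`-centers** (Bamler 2023, §4, the display before §4.1: *"if
`x'₁, x'₂ ∈ 𝒳_s` denote `H`-centers of `x₁, x₂`, then we have the following distance shrinking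
estimate `d_s(x'₁, x'₂) ≤ d_{W₁}(δ_{x'₁}, ν_{x₁;s}) + d_{W₁}(ν_{x₁;s}, ν_{x₂;s}) +
d_{W₁}(ν_{x₂;s}, δ_{x'₂}) ≤ … ≤ d_t(x₁, x₂) + 2√(H(t − s))`"*), for a compact slice `𝒳_s`; here
the triangle inequality `d_s(z₁, z₂) ≤ d_s(z₁, y₁) + d_s(y₁, y₂) + d_s(y₂, z₂)` is integrated
against an arbitrary coupling of `ν_{x₁;s}, ν_{x₂;s}` (so no triangle inequality for `d_{W₁}` is
needed), `∫ d(zᵢ, ·) dν_{xᵢ;s} ≤ √Var(δ_{zᵢ}, ν_{xᵢ;s}) ≤ √(H(t − s))`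
(`lintegral_lintegral_edist_le_sqrt_variance`, definition of an `H`-center) and
`d_{W₁}(ν_{x₁;s}, ν_{x₂;s}) ≤ d_t(x₁, x₂)` is (c). [cite: Bamler2023, §4, display before §4.1] -/
theorem IsHCenter.edist_le_edist_add {H : ℝ} {s t : I} [CompactSpace (𝒳.Slice s)]
    {x₁ x₂ : 𝒳.Slice t} {z₁ z₂ : 𝒳.Slice s} (h₁ : 𝒳.IsHCenter H z₁ x₁)
    (h₂ : 𝒳.IsHCenter H z₂ x₂) :
    edist z₁ z₂ ≤ edist x₁ x₂ + 2 * (ENNReal.ofReal (H * ((t : ℝ) - s))) ^ (1 / 2 : ℝ) := by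
  have hst : (s : ℝ) ≤ t := h₁.1
  haveI := 𝒳.isProbabilityMeasure_condKernel x₁ hst
  haveI := 𝒳.isProbabilityMeasure_condKernel x₂ hst
  haveI : SecondCountableTopology (𝒳.Slice s) := UniformSpace.secondCountable_of_separable _
  set ν₁ := 𝒳.condKernel x₁ s with hν₁
  set ν₂ := 𝒳.condKernel x₂ s with hν₂
  set R : ℝ≥0∞ := (ENNReal.ofReal (H * ((t : ℝ) - s))) ^ (1 / 2 : ℝ) with hR
  -- the two Dirac terms
  have hA₁ : ∫⁻ y, edist z₁ y ∂ν₁ ≤ R := by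
    have h := lintegral_lintegral_edist_le_sqrt_variance (Measure.dirac z₁) ν₁
    rw [lintegral_dirac] at h
    exact h.trans (ENNReal.rpow_le_rpow h₁.2 (by norm_num))
  have hA₂ : ∫⁻ y, edist y z₂ ∂ν₂ ≤ R := by
    have h := lintegral_lintegral_edist_le_sqrt_variance (Measure.dirac z₂) ν₂
    rw [lintegral_dirac] at h
    simp_rw [edist_comm _ z₂]
    exact h.trans (ENNReal.rpow_le_rpow h₂.2 (by norm_num))
  -- the triangle inequality integrated against a coupling
  have hq : ∀ q : {q : Measure (𝒳.Slice s × 𝒳.Slice s) // IsCoupling ν₁ ν₂ q},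
      edist z₁ z₂ ≤ (∫⁻ y, edist z₁ y ∂ν₁ + ∫⁻ y, edist y z₂ ∂ν₂) +
        ∫⁻ p, edist p.1 p.2 ∂(q : Measure (𝒳.Slice s × 𝒳.Slice s)) := by
    rintro ⟨q, hqP, hq1, hq2⟩
    haveI := hqP
    have hm1 : Measurable fun p : 𝒳.Slice s × 𝒳.Slice s ↦ edist z₁ p.1 :=
      measurable_const.edist measurable_fst
    have hm2 : Measurable fun p : 𝒳.Slice s × 𝒳.Slice s ↦ edist p.1 p.2 := measurable_edist
    have hm3 : Measurable fun p : 𝒳.Slice s × 𝒳.Slice s ↦ edist p.2 z₂ :=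
      measurable_snd.edist measurable_const
    have hI1 : ∫⁻ p, edist z₁ p.1 ∂q = ∫⁻ y, edist z₁ y ∂ν₁ := by
      rw [← hq1, Measure.fst, lintegral_map
        (show Measurable fun y : 𝒳.Slice s ↦ edist z₁ y from measurable_const.edist measurable_id)
        measurable_fst]
    have hI3 : ∫⁻ p, edist p.2 z₂ ∂q = ∫⁻ y, edist y z₂ ∂ν₂ := by
      rw [← hq2, Measure.snd, lintegral_map
        (show Measurable fun y : 𝒳.Slice s ↦ edist y z₂ from measurable_id.edist measurable_const)
        measurable_snd]
    calc edist z₁ z₂ = ∫⁻ _, edist z₁ z₂ ∂q := by rw [lintegral_const, measure_univ, mul_one]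
      _ ≤ ∫⁻ p, edist z₁ p.1 + edist p.1 p.2 + edist p.2 z₂ ∂q :=
          lintegral_mono fun p ↦ edist_triangle4 _ _ _ _
      _ = ∫⁻ p, edist z₁ p.1 ∂q + ∫⁻ p, edist p.1 p.2 ∂q + ∫⁻ p, edist p.2 z₂ ∂q := by
          rw [lintegral_add_right _ hm3, lintegral_add_left hm1]
      _ = (∫⁻ y, edist z₁ y ∂ν₁ + ∫⁻ y, edist y z₂ ∂ν₂) + ∫⁻ p, edist p.1 p.2 ∂q := by
          rw [hI1, hI3]; ring
  have hW : edist z₁ z₂ ≤ (∫⁻ y, edist z₁ y ∂ν₁ + ∫⁻ y, edist y z₂ ∂ν₂) + wassersteinW1 ν₁ ν₂ := by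
    calc edist z₁ z₂ ≤ ⨅ q : {q : Measure (𝒳.Slice s × 𝒳.Slice s) // IsCoupling ν₁ ν₂ q},
        ((∫⁻ y, edist z₁ y ∂ν₁ + ∫⁻ y, edist y z₂ ∂ν₂) +
          ∫⁻ p, edist p.1 p.2 ∂(q : Measure (𝒳.Slice s × 𝒳.Slice s))) := le_iInf hq
      _ = _ := ENNReal.add_iInf.symm
  have hc : wassersteinW1 ν₁ ν₂ ≤ edist x₁ x₂ := 𝒳.wassersteinW1_condKernel_le_edist hst x₁ x₂
  calc edist z₁ z₂ ≤ (∫⁻ y, edist z₁ y ∂ν₁ + ∫⁻ y, edist y z₂ ∂ν₂) + wassersteinW1 ν₁ ν₂ := hW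
    _ ≤ (R + R) + edist x₁ x₂ := add_le_add (add_le_add hA₁ hA₂) hc
    _ = edist x₁ x₂ + 2 * R := by rw [two_mul, add_comm]

/-- **`∫∫ d_s dν_{y₁;s} dν_{y₂;s} ≤ d_{W₁}(ν_{y₁;s}, ν_{y₂;s}) + √(H(t − s))`** in an
`H`-concentrated metric flow (Bamler 2023, §4.2, proof of the Lemma, first display, last step:
`√Var(ν_{y₂;s}) ≤ √(H(t − s))`). [cite: Bamler2023, §4.2, proof of the Lemma (almost monotonicity), first display] -/
theorem IsHConcentrated.lintegral_lintegral_edist_condKernel_le {H : ℝ} (hH : 𝒳.IsHConcentrated H)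
    {s t : I} (hst : (s : ℝ) ≤ t) (y₁ y₂ : 𝒳.Slice t) :
    ∫⁻ x₁, ∫⁻ x₂, edist x₁ x₂ ∂(𝒳.condKernel y₂ s) ∂(𝒳.condKernel y₁ s) ≤
      wassersteinW1 (𝒳.condKernel y₁ s) (𝒳.condKernel y₂ s) +
        (ENNReal.ofReal (H * ((t : ℝ) - s))) ^ (1 / 2 : ℝ) := by
  haveI := 𝒳.isProbabilityMeasure_condKernel y₁ hst
  haveI := 𝒳.isProbabilityMeasure_condKernel y₂ hst
  haveI : SecondCountableTopology (𝒳.Slice s) := UniformSpace.secondCountable_of_separable _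
  refine (lintegral_lintegral_edist_le_wassersteinW1_add _ _).trans (add_le_add le_rfl ?_)
  exact ENNReal.rpow_le_rpow (hH.variance_condKernel_self_le_ofReal hst y₂) (by norm_num)

/-- **The first half of Bamler 2023, (4.3)**: in an `H`-concentrated metric flow with compact
slice `𝒳_s`, for `y₁, y₂ ∈ 𝒳_t`, `s ≤ t`:
`∫∫ d_s dν_{y₁;s} dν_{y₂;s} ≤ d_t(y₁, y₂) + √(H(t − s))` — i.e. with
`f(y₁, y₂) := d_t(y₁, y₂) − d_{W₁}(ν_{y₁;s}, ν_{y₂;s}) ≥ 0` ((c),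
`wassersteinW1_condKernel_le_edist`): `f ≤ d_t(y₁, y₂) − ∫∫ d_s dν_{y₁;s} dν_{y₂;s} + √(H(t − s))`.
[cite: Bamler2023, §4.2, Lemma (almost monotonicity), (4.3)] -/
theorem IsHConcentrated.lintegral_lintegral_edist_condKernel_le_edist {H : ℝ}
    (hH : 𝒳.IsHConcentrated H) {s t : I} [CompactSpace (𝒳.Slice s)] (hst : (s : ℝ) ≤ t)
    (y₁ y₂ : 𝒳.Slice t) :
    ∫⁻ x₁, ∫⁻ x₂, edist x₁ x₂ ∂(𝒳.condKernel y₂ s) ∂(𝒳.condKernel y₁ s) ≤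
      edist y₁ y₂ + (ENNReal.ofReal (H * ((t : ℝ) - s))) ^ (1 / 2 : ℝ) :=
  (hH.lintegral_lintegral_edist_condKernel_le hst y₁ y₂).trans
    (add_le_add (𝒳.wassersteinW1_condKernel_le_edist hst y₁ y₂) le_rfl)

end MetricFlow

end Literature.Geometry.Riemannian

end
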